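import Literature.AlgebraicGeometry.Frobenioids.PadicKummerRemark221Coprime
import HarnessLib

/-!
# Frobenioids II, Remark 2.2.1: the Kummer INJECTION `Mˣ/Mˣᴺ ↪ H¹(Gal(K̄/M), μ_N)` bounding `H¹(H, μ_N(A))` below

Mochizuki, *The geometry of Frobenioids II*, Kyushu J. Math. **62** (2008) 401–460, §2, Remark 2.2.1
p. 18 [cite: MochizukiFrdII2008, Rmk 2.2.1 p.18]: "it follows immediately from the definitions [i.e.,
by translating into extension field-theoretic language the Galois cohomological conditions of Definition
2.2 (ii) (c)] … that any element `f ∈ O^□(A)^H` admits an `N`-th root `g ∈ O^□(A)`".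

PROOF-ONLY companion of `PadicKummerRemark221.lean` (abc-iut-L1-t7) and
`PadicKummerRemark221Coprime.lean` (abc-iut-E-t32), abc-iut cell, D-0079 L-F [FrdI/II], GAP-2R on
FACT-LIST row F-1198 `SaturatedInvariantsAdmitRoots` (GENERAL `N`). The "translation into extension
field-theoretic language" of condition (c) on FIRST cohomology is done by two INJECTIONS (no
surjectivity and no transport of cohomology along `Γ_M ≅ H` is needed); this file is the first:

* **Kummer injection (below `H¹(H, μ_N)`).** For ANY field `K` of characteristic `0`, a subextension
  `M ⊆ K̄` and `H = Gal(K̄/M) ≤ Γ_K` (`galFixing K M`, subspace topology):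
  `Mˣ/Mˣᴺ ↪ H¹(H, μ_N(K̄)|_H)`, `a ↦ [σ ↦ σ(α)/α]`, `αᴺ = a`
  (`exists_injective_unitsQuot_to_h1_galFixing`, whence `natCard_unitsQuot_le_natCard_h1_galFixing`
  when the target is finite). The cocycles are abc-iut-L1-t7's `kummerCocycleOn` (their algebra:
  `kummerCocycleOn_mul`, `…_eq_zero_of_forall_smul_eq`, `oneCocycleClass_kummerCocycleOn_eq_zero_of_pow_eq_one`,
  `exists_smul_div_eq_of_oneCocycleClass_kummerCocycleOn_eq_zero`); injectivity: a principal Kummer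
  cocycle `σ(α)/α = σ(ζ)/ζ` makes `α/ζ` `H`-invariant, i.e. in `M` (`mem_of_forall_galFixing_smul_eq`),
  so `a = (α/ζ)ᴺ ∈ Mˣᴺ`.

The second injection (Hilbert 90, above `H¹(H_A, μ_N(A))`) is `PadicKummerRemark221Hilbert90.lean`;
consumer: `PadicKummerRemark221General.lean`. Nothing here concerns [IUTchIII]; classical Kummer
theory. Universe `0` (as the parents).
-/

noncomputable section

namespace Literature.AlgebraicGeometry.Frobenioids

namespace PadicKummer

namespace Def22Context

open Field IntermediateField
open Literature.NumberTheory.GaloisRepresentations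
open Literature.NumberTheory.GaloisRepresentations.LocalWeilDatum
open Literature.NumberTheory.GaloisRepresentations.DiscreteGaloisModule

/-! ### The Kummer cocycles on a subgroup `H ≤ Γ_K`: algebra -/

section KummerAlgebra

variable {K : Type} [Field K] (H : Subgroup (absoluteGaloisGroup K)) (N : ℕ)

/-- The Kummer cocycle of a product is the sum of the Kummer cocycles: `σ(αβ)/(αβ) = (σα/α)(σβ/β)`.
[cite: MochizukiFrdII2008, Rmk 2.2.1 p.18] -/
theorem kummerCocycleOn_mul (α β : (AlgebraicClosure K)ˣ)
    (hα : ∀ σ : absoluteGaloisGroup K, σ ∈ H → σ • α ^ N = α ^ N)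
    (hβ : ∀ σ : absoluteGaloisGroup K, σ ∈ H → σ • β ^ N = β ^ N)
    (hαβ : ∀ σ : absoluteGaloisGroup K, σ ∈ H → σ • (α * β) ^ N = (α * β) ^ N) :
    kummerCocycleOn H N (α * β) hαβ = kummerCocycleOn H N α hα + kummerCocycleOn H N β hβ := by
  apply Subtype.ext
  ext σ
  apply muVal_injective K N
  rw [Submodule.coe_add, ContinuousMap.add_apply, muVal_add, muVal_kummerCocycleOn,
    muVal_kummerCocycleOn, muVal_kummerCocycleOn, smul_mul', mul_div_mul_comm]

/-- The Kummer cocycle of an `H`-INVARIANT unit is zero. [cite: MochizukiFrdII2008, Rmk 2.2.1 p.18] -/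
theorem kummerCocycleOn_eq_zero_of_forall_smul_eq (c : (AlgebraicClosure K)ˣ)
    (hc : ∀ σ : absoluteGaloisGroup K, σ ∈ H → σ • c = c)
    (hcN : ∀ σ : absoluteGaloisGroup K, σ ∈ H → σ • c ^ N = c ^ N) :
    kummerCocycleOn H N c hcN = 0 := by
  apply Subtype.ext
  ext σ
  apply muVal_injective K N
  rw [muVal_kummerCocycleOn, Submodule.coe_zero, ContinuousMap.zero_apply, muVal_zero, hc σ σ.2,
    div_self']

/-- The class of the Kummer cocycle of a ROOT OF UNITY `ζ` is zero (it is the coboundary of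
`ζ ∈ μ_N(K̄)`). [cite: MochizukiFrdII2008, Rmk 2.2.1 p.18] -/
theorem oneCocycleClass_kummerCocycleOn_eq_zero_of_pow_eq_one (ζ : (AlgebraicClosure K)ˣ)
    (hζ : ζ ^ N = 1) (hζN : ∀ σ : absoluteGaloisGroup K, σ ∈ H → σ • ζ ^ N = ζ ^ N) :
    oneCocycleClass _ (kummerCocycleOn H N ζ hζN) = 0 := by
  rw [oneCocycleClass_eq_zero_iff]
  refine ⟨MuCarrier.ofRootsOfUnity ⟨ζ, (mem_rootsOfUnity N ζ).mpr hζ⟩, fun σ => ?_⟩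
  apply muVal_injective K N
  rw [muVal_kummerCocycleOn, muVal_sub]
  rfl

/-- A Kummer cocycle with TRIVIAL class comes from an `H`-invariant element: if `[σ ↦ σ(α)/α] = 0` in
`H¹(H, μ_N(K̄)|_H)` then `σ(α)/α = σ(ζ)/ζ` for some `ζ ∈ μ_N(K̄)`, i.e. `α/ζ` is fixed by `H`.
[cite: MochizukiFrdII2008, Rmk 2.2.1 p.18] -/
theorem exists_smul_div_eq_of_oneCocycleClass_kummerCocycleOn_eq_zero (α : (AlgebraicClosure K)ˣ)
    (hα : ∀ σ : absoluteGaloisGroup K, σ ∈ H → σ • α ^ N = α ^ N)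
    (h0 : oneCocycleClass _ (kummerCocycleOn H N α hα) = 0) :
    ∃ ζ : (AlgebraicClosure K)ˣ, ζ ^ N = 1 ∧
      ∀ σ : absoluteGaloisGroup K, σ ∈ H → σ • (α / ζ) = α / ζ := by
  rw [oneCocycleClass_eq_zero_iff] at h0
  obtain ⟨v, hv⟩ := h0
  refine ⟨muVal K N v, muVal_pow_eq_one K N v, fun σ hσ => ?_⟩
  have h1 := congrArg (muVal K N) (hv ⟨σ, hσ⟩)
  rw [muVal_kummerCocycleOn, muVal_sub] at h1
  change σ • α / α = σ • muVal K N v / muVal K N v at h1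
  rw [div_eq_div_iff_mul_eq_mul] at h1
  rw [smul_div', div_eq_div_iff_mul_eq_mul, h1, mul_comm]

end KummerAlgebra

/-! ### The Kummer injection `Mˣ/Mˣᴺ ↪ H¹(Gal(K̄/M), μ_N)` -/

section KummerInjection

variable {K : Type} [Field K] [CharZero K] (M : IntermediateField K (AlgebraicClosure K)) (N : ℕ)
  [NeZero N]

omit [CharZero K] in
/-- An `N`-th root in `K̄ˣ` of (the image in `K̄` of) a unit of `M`. [folklore] -/
private theorem exists_root (a : Mˣ) :
    ∃ α : (AlgebraicClosure K)ˣ, (α : AlgebraicClosure K) ^ N = ((a : M) : AlgebraicClosure K) := by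
  have ha0 : (((a : M) : AlgebraicClosure K)) ≠ 0 := by
    rw [Ne, ZeroMemClass.coe_eq_zero]; exact a.ne_zero
  obtain ⟨x, hx⟩ := IsAlgClosed.exists_pow_nat_eq ((a : M) : AlgebraicClosure K) (NeZero.pos N)
  have hx0 : x ≠ 0 := fun h => ha0 (by rw [← hx, h, zero_pow (NeZero.ne N)])
  exact ⟨Units.mk0 x hx0, hx⟩

omit [CharZero K] [NeZero N] in
/-- The `N`-th power of a root of `a ∈ Mˣ` is fixed by `Gal(K̄/M)`. [folklore] -/
private theorem smul_pow_eq_of_root {a : Mˣ} {α : (AlgebraicClosure K)ˣ}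
    (hα : (α : AlgebraicClosure K) ^ N = ((a : M) : AlgebraicClosure K))
    (σ : absoluteGaloisGroup K) (hσ : σ ∈ galFixing K M) : σ • α ^ N = α ^ N := by
  apply Units.ext
  rw [Units.coe_smul, Units.val_pow_eq_pow_val, hα]
  exact (mem_galFixing_iff K).mp hσ _ (a : M).2

/-- **The Kummer injection.** For a field `K` of characteristic `0`, a subextension `M ⊆ K̄`,
`H = Gal(K̄/M) ≤ Γ_K` and `N ≥ 1`: there is an INJECTIVE map
`Mˣ/Mˣᴺ ↪ H¹(H, μ_N(K̄)|_H)` — the class of `a` goes to the class of the Kummer cocycle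
`σ ↦ σ(α)/α` of an `N`-th root `α` of `a`. (Only injectivity: `[σ ↦ σα/α] = [σ ↦ σβ/β]` forces
`(α/β)/ζ ∈ K̄^H = M` for a root of unity `ζ`, hence `a/b = ((α/β)/ζ)ᴺ ∈ Mˣᴺ`.)
[cite: MochizukiFrdII2008, Rmk 2.2.1 p.18] -/
theorem exists_injective_unitsQuot_to_h1_galFixing :
    ∃ g : Mˣ ⧸ (powMonoidHom N : Mˣ →* Mˣ).range →
        (continuousCohomology 1 ((mu K N).restrict (subgroupIncl (galFixing K M))).toTopRep :
          TopModuleCat ℤ),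
      Function.Injective g := by
  classical
  set H := galFixing K M with hH
  -- chosen roots
  choose root hroot using exists_root M N
  have hrootN : ∀ a : Mˣ, ∀ σ : absoluteGaloisGroup K, σ ∈ H → σ • root a ^ N = root a ^ N :=
    fun a σ hσ => smul_pow_eq_of_root M N (hroot a) σ hσ
  -- the map on `Mˣ`
  let f : Mˣ → (continuousCohomology 1 ((mu K N).restrict (subgroupIncl H)).toTopRep :
      TopModuleCat ℤ) := fun a => oneCocycleClass _ (kummerCocycleOn H N (root a) (hrootN a))
  -- key: `f a = f b ↔ a⁻¹ b ∈ Mˣᴺ`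
  have hM : ∀ {x : AlgebraicClosure K}, (∀ σ : absoluteGaloisGroup K, σ ∈ H → σ • x = x) → x ∈ M :=
    fun hx => mem_of_forall_galFixing_smul_eq M hx
  have key₁ : ∀ a b : Mˣ, a⁻¹ * b ∈ (powMonoidHom N : Mˣ →* Mˣ).range → f a = f b := by
    intro a b hab
    obtain ⟨c, hc⟩ := hab
    rw [powMonoidHom_apply, eq_inv_mul_iff_mul_eq] at hc
    -- `root b = ζ · root a · c` with `ζ^N = 1`
    have hc0 : (((c : M) : AlgebraicClosure K)) ≠ 0 := by
      rw [Ne, ZeroMemClass.coe_eq_zero]; exact c.ne_zero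
    let cu : (AlgebraicClosure K)ˣ := Units.mk0 _ hc0
    have hcu : ∀ σ : absoluteGaloisGroup K, σ ∈ H → σ • cu = cu := fun σ hσ => by
      apply Units.ext
      rw [Units.coe_smul, Units.val_mk0]
      exact (mem_galFixing_iff K).mp hσ _ (c : M).2
    have hcuN : ∀ σ : absoluteGaloisGroup K, σ ∈ H → σ • cu ^ N = cu ^ N := fun σ hσ => by
      rw [smul_pow', hcu σ hσ]
    let ζ : (AlgebraicClosure K)ˣ := root b / (root a * cu)
    have hζ : ζ ^ N = 1 := by
      apply Units.ext
      rw [Units.val_pow_eq_pow_val, Units.val_one]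
      change (((root b / (root a * cu) : (AlgebraicClosure K)ˣ)) : AlgebraicClosure K) ^ N = 1
      rw [Units.val_div_eq_div_val, Units.val_mul, Units.val_mk0, div_pow, mul_pow, hroot b, hroot a,
        ← hc, Units.val_mul, Units.val_pow_eq_pow_val]
      push_cast
      rw [div_self]
      exact mul_ne_zero (by rw [Ne, ZeroMemClass.coe_eq_zero]; exact a.ne_zero)
        (pow_ne_zero _ hc0)
    have hζN : ∀ σ : absoluteGaloisGroup K, σ ∈ H → σ • ζ ^ N = ζ ^ N := fun σ _ => by
      rw [hζ, smul_one]
    have hdecomp : root b = ζ * (root a * cu) := by rw [div_mul_cancel]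
    have hprodN : ∀ σ : absoluteGaloisGroup K, σ ∈ H → σ • (root a * cu) ^ N = (root a * cu) ^ N :=
      fun σ hσ => by rw [mul_pow, smul_mul', hrootN a σ hσ, hcuN σ hσ]
    have hall : ∀ σ : absoluteGaloisGroup K, σ ∈ H → σ • (ζ * (root a * cu)) ^ N = (ζ * (root a * cu)) ^ N :=
      fun σ hσ => by rw [← hdecomp]; exact hrootN b σ hσ
    have hcocycle : kummerCocycleOn H N (root b) (hrootN b) =
        kummerCocycleOn H N ζ hζN + (kummerCocycleOn H N (root a) (hrootN a) + kummerCocycleOn H N cu hcuN) := by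
      have h1 : kummerCocycleOn H N (root b) (hrootN b) = kummerCocycleOn H N (ζ * (root a * cu)) hall := by
        apply Subtype.ext; ext σ; apply muVal_injective K N
        rw [muVal_kummerCocycleOn, muVal_kummerCocycleOn, hdecomp]
      rw [h1, kummerCocycleOn_mul H N ζ (root a * cu) hζN hprodN,
        kummerCocycleOn_mul H N (root a) cu (hrootN a) hcuN]
    change oneCocycleClass _ (kummerCocycleOn H N (root a) (hrootN a)) =
      oneCocycleClass _ (kummerCocycleOn H N (root b) (hrootN b))
    rw [hcocycle, oneCocycleClass_add, oneCocycleClass_add,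
      oneCocycleClass_kummerCocycleOn_eq_zero_of_pow_eq_one H N ζ hζ,
      kummerCocycleOn_eq_zero_of_forall_smul_eq H N cu hcu, oneCocycleClass_zero, zero_add, add_zero]
  have key₂ : ∀ a b : Mˣ, f a = f b → a⁻¹ * b ∈ (powMonoidHom N : Mˣ →* Mˣ).range := by
    intro a b hab
    -- the cocycle of `root b / root a` has trivial class
    have hq : ∀ σ : absoluteGaloisGroup K, σ ∈ H → σ • (root b * (root a)⁻¹) ^ N = (root b * (root a)⁻¹) ^ N :=
      fun σ hσ => by rw [mul_pow, inv_pow, smul_mul', smul_inv', hrootN a σ hσ, hrootN b σ hσ]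
    have hinvN : ∀ σ : absoluteGaloisGroup K, σ ∈ H → σ • ((root a)⁻¹) ^ N = ((root a)⁻¹) ^ N :=
      fun σ hσ => by rw [inv_pow, smul_inv', hrootN a σ hσ]
    have hsum : kummerCocycleOn H N (root a) (hrootN a) + kummerCocycleOn H N (root a)⁻¹ hinvN = 0 := by
      rw [← kummerCocycleOn_mul H N (root a) (root a)⁻¹ (hrootN a) hinvN
        (fun σ _ => by rw [mul_inv_cancel, one_pow, smul_one])]
      exact kummerCocycleOn_eq_zero_of_forall_smul_eq H N _ (fun σ _ => by rw [mul_inv_cancel, smul_one]) _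
    have h0 : oneCocycleClass _ (kummerCocycleOn H N (root b * (root a)⁻¹) hq) = 0 := by
      rw [kummerCocycleOn_mul H N (root b) (root a)⁻¹ (hrootN b) hinvN, oneCocycleClass_add,
        eq_neg_of_add_eq_zero_right (by rw [← oneCocycleClass_add, hsum, oneCocycleClass_zero] :
          oneCocycleClass _ (kummerCocycleOn H N (root a) (hrootN a)) +
            oneCocycleClass _ (kummerCocycleOn H N (root a)⁻¹ hinvN) = 0)]
      change f b + -f a = 0
      rw [hab, add_neg_cancel]
    obtain ⟨ζ, hζ, hfix⟩ :=
      exists_smul_div_eq_of_oneCocycleClass_kummerCocycleOn_eq_zero H N _ hq h0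
    -- `w := (root b / root a) / ζ ∈ M` and `w^N = b / a`
    set w : AlgebraicClosure K := ((root b * (root a)⁻¹ / ζ : (AlgebraicClosure K)ˣ) : AlgebraicClosure K)
      with hw
    have hwM : w ∈ M := hM fun σ hσ => by
      rw [hw, ← Units.coe_smul, hfix σ hσ]
    have hwN : w ^ N = ((b : M) : AlgebraicClosure K) / ((a : M) : AlgebraicClosure K) := by
      rw [hw, ← Units.val_pow_eq_pow_val, div_pow, (Units.ext (by
          rw [Units.val_pow_eq_pow_val, Units.val_one]; exact congrArg Units.val hζ |>.trans rfl) :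
          ζ ^ N = 1), div_one, mul_pow, inv_pow, Units.val_mul, Units.val_inv_eq_inv_val,
        Units.val_pow_eq_pow_val, Units.val_pow_eq_pow_val, hroot a, hroot b, div_eq_mul_inv]
    have hw0 : (⟨w, hwM⟩ : M) ≠ 0 := by
      intro h
      have h' : w = 0 := congrArg Subtype.val h
      have : w ^ N = 0 := by rw [h', zero_pow (NeZero.ne N)]
      rw [hwN, div_eq_zero_iff] at this
      rcases this with h1 | h1
      · exact b.ne_zero (by exact_mod_cast h1)
      · exact a.ne_zero (by exact_mod_cast h1)
    refine ⟨Units.mk0 ⟨w, hwM⟩ hw0, ?_⟩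
    rw [powMonoidHom_apply, eq_inv_mul_iff_mul_eq]
    apply Units.ext
    apply Subtype.ext
    rw [Units.val_mul, Units.val_pow_eq_pow_val, Units.val_mk0]
    change ((a : M) : AlgebraicClosure K) * w ^ N = ((b : M) : AlgebraicClosure K)
    rw [hwN, mul_div_cancel₀]
    rw [Ne, ZeroMemClass.coe_eq_zero]; exact a.ne_zero
  -- descend to the quotient
  refine ⟨Quotient.lift f (fun a b hab => key₁ a b (QuotientGroup.leftRel_apply.mp hab)), ?_⟩
  intro x y hxy
  induction x using QuotientGroup.induction_on with
  | H a =>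
    induction y using QuotientGroup.induction_on with
    | H b => exact QuotientGroup.eq.mpr (key₂ a b hxy)

/-- **`#(Mˣ/Mˣᴺ) ≤ #H¹(Gal(K̄/M), μ_N(K̄))`** whenever the right-hand side is finite (the Kummer
injection). [cite: MochizukiFrdII2008, Rmk 2.2.1 p.18] -/
theorem natCard_unitsQuot_le_natCard_h1_galFixing
    [Finite (continuousCohomology 1 ((mu K N).restrict (subgroupIncl (galFixing K M))).toTopRep)] :
    Nat.card (Mˣ ⧸ (powMonoidHom N : Mˣ →* Mˣ).range) ≤
      Nat.card (continuousCohomology 1 ((mu K N).restrict (subgroupIncl (galFixing K M))).toTopRep) := by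
  obtain ⟨g, hg⟩ := exists_injective_unitsQuot_to_h1_galFixing M N
  exact Nat.card_le_card_of_injective g hg

end KummerInjection

end Def22Context

end PadicKummer

end Literature.AlgebraicGeometry.Frobenioids

end
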